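import Summits.QuantumFields.BalabanUV.T4Continuum.Support.ShellMeasureRootCompositionSync
import Summits.QuantumFields.BalabanUV.T4Continuum.Support.ShellMeasureThresholdUnits

/-!
# `T4Continuum.ShellMeasureThresholdUnitsEnd` — owner audit (γ8), file 2: END-I along the cutoff scheme FED IN THE FINE
# CURRENCY of the live-level END (per-slot (M1) at `ε(age)·η²` for the RAW tested variable), the unit change done inside
(cell `pub-balaban`, sub-cell `t4`, spine estimate NE7c (node U5b); owner lineage `b2b-balaban-t4-ne7c-p1` gen 33, owner
table `t4/b2b-balaban-t4-ne7c-p1/LEAVES-NE7c-P1.md` row **S90 f2**; owner NOTE N-ne7cp1-g33-1; ADDITIVE — imports S27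
`ShellMeasureRootCompositionSync` (p211299 lineage; END-I realized along the cutoff scheme, thresholds by AGE) and S90 f1
`ShellMeasureThresholdUnits` (p229839) ONLY, cited BY NAME; [folklore]; 0 `def`, 0 `def … : Prop`, 0 sorry, 0 citation
tags)

HONEST FRAMING.  Finite four-torus programme, rung (B)+1 only — NOT infinite volume, NOT a mass gap, NOT the Clay
problem, NOT summit progress; (B), `BetaPertHyp`, (B^μ) not consumed.  NE7c (`T4IndicatorShell.ShellWeightBound`) is NOT
PRINTED in [Balaban 1983–89] and NOT PROVED; «NE7c ⇐ the named binders» (trigger c3).  Nothing printed is asserted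
here; no estimate of Bałaban's is discharged.  This file is the END-I-side half of the γ8 junction: ONE call of S27's
`ShellMeasureRootCompositionSync.shellWeightBound_of_schemeData_age` with its per-slot (M1) binders `hacA`∕`hacB` and its
(R)+[dict] shell events RE-TYPED in the FINE currency the live-level END-II hosts conclude in.

WHAT IS PROVED ([folklore] bookkeeping).
* `shell_fine_eq` — the fine shell event `{ε·η²·(1−ρ) ≤ u < ε·η²}` IS the threshold-units shell event
  `{ε(1−ρ) ≤ u∕η² < ε}` (`ShellMeasureThresholdUnits.shell_unitChange` with the factors in END-II's order).
* **`shellWeightBound_of_schemeData_age_fine`** — END-I along the cutoff scheme `Psch` (run A = the `K`-step run, slot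
  `s` at level `lvlA K s`; run B = the `(K+1)`-step run, slot at level `lvlB K s + 1`; thresholds by AGE `εX (K − lvl)`,
  ONE K-free profile per run) for the RAW fine tested variables `uAf`∕`uBf`, each run with ITS OWN positive scale family
  `ηA`∕`ηB : ℕ → ℝ` read at the slot's level (`ηA (lvlA K s)`, `ηB (lvlB K s + 1)` — at the paired slot run B's fine
  lattice is finer by `L`): the per-slot (M1) binders are taken LITERALLY in the END-II currency
  `SlotAntiConcentration (… .withDensity (FA K t s)) (uAf K t s) (εA (K − lvlA K s) * ηA (lvlA K s) ^ 2) (ρA …) (DslotA …)`,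
  the (R)+[dict] binder `piece_le` with the fine shell event; conclusion LITERALLY END-I's
  `ShellWeightBound l₀ T A B shA shB (fun K ↦ Σ_{s∈SA K} DA(lvl)·ρA(lvl) + Σ_{s∈SB K} DB(lvl)·ρB(lvl))`.  Proof: S27's END
  at the NORMALISED variables `uAf∕ηA(lvl)²`, `uBf∕ηB(lvl+1)²`, the (M1)s transported by
  `ShellMeasureThresholdUnits.slotAntiConcentration_thresholdUnits`, the shell events by `shell_fine_eq`.
So the composer of row S92 («THE ONE CALL at the live levels») fires THIS declaration with `hacA`∕`hacB` := the
most-assembled END-II of record (`ShellMeasureLandauEndRayStokesAssembledDecay.slotAC_realized_su2_landauChart_assembled_decay`)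
per `(K, t, s)` and has no unit bookkeeping left to do.  Displayed as before: the (R)+[dict] binders (`cover`,
`piece_le`, `total_ge`), the slot→level majorants, (W1) `LiveWindow` ×2, `D ≤ D̄`, the rates `ρ_j ≤ c₁ϑ^j` (node U1b BY
NAME — in THRESHOLD UNITS, N-ne7cp1-g33-1: the closeness behind `piece_le` is U1b's `T4SupCloseLiaison` convention for
the normalised readings; read on the raw fine variables it is false on every live shell,
`ShellMeasureThresholdUnits.fineCurrency_closeness_fails`).  NOTHING in the countdown moves; NE7c NOT PROVED; spine
PROVED 0∕9.  HONEST DEPENDENCY (cell): continuum YM on T⁴ ⇐ BetaPertH ∧ nine spine estimates (0/9 proved); BetaPertH ⇐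
(D1) ∧ (D4) ∧ CAP+tail; G-an2-4 gates asym, D1 and NE2/3/4.
-/

noncomputable section

open Set MeasureTheory Finset

namespace Summit.QuantumFields.BalabanUV.T4Continuum.ShellMeasureThresholdUnitsEnd

open scoped ENNReal
open Literature.MathematicalPhysics.QuantumFieldTheory.Balaban1983to89
open T4ShellMeasure (SlotAntiConcentration)
open T4ShellMeasureLevels (LiveWindow)
open T4IndicatorShell (ShellWeightBound)
open ShellMeasureThresholdUnits (shell_unitChange slotAntiConcentration_thresholdUnits)
open ShellMeasureRootCompositionSync (shellWeightBound_of_schemeData_age)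

/-- **THE FINE SHELL EVENT IS THE THRESHOLD-UNITS SHELL EVENT**, with the factors in END-II's order `ε * η ^ 2`:
`{x | ε·η²·(1−ρ) ≤ u x ∧ u x < ε·η²} = {x | ε(1−ρ) ≤ u x∕η² ∧ u x∕η² < ε}` (`η > 0`). [folklore] -/
theorem shell_fine_eq {X : Type*} (u : X → ℝ) (ε ρ : ℝ) {η : ℝ} (hη : 0 < η) :
    {x | ε * η ^ 2 * (1 - ρ) ≤ u x ∧ u x < ε * η ^ 2} = {x | ε * (1 - ρ) ≤ u x / η ^ 2 ∧ u x / η ^ 2 < ε} := by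
  rw [mul_comm ε (η ^ 2)]
  exact shell_unitChange u ε ρ (pow_pos hη 2)

section Age

variable {ι σ σ' : Type*} {l₀ : ℝ} {T : ℕ → Finset ι} {G : Type*} [GaugeGroup G] [MeasurableSpace G] [HaarData G]
  {A B shA shB : ℕ → ℝ → ι → ℝ} {SA : ℕ → Finset σ} {SB : ℕ → Finset σ'}
  {pieceA : ℕ → ℝ → σ → ι → ℝ} {pieceB : ℕ → ℝ → σ' → ι → ℝ} {lvlA : ℕ → σ → ℕ} {lvlB : ℕ → σ' → ℕ}
  {Psch : ℕ → Params}
  {FA : ∀ K : ℕ, ℝ → ∀ s : σ, GaugeField (Psch K) (lvlA K s) G → ℝ≥0∞}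
  {FB : ∀ K : ℕ, ℝ → ∀ s : σ', GaugeField (Psch (K + 1)) (lvlB K s + 1) G → ℝ≥0∞}
  {uAf : ∀ K : ℕ, ℝ → ∀ s : σ, GaugeField (Psch K) (lvlA K s) G → ℝ}
  {uBf : ∀ K : ℕ, ℝ → ∀ s : σ', GaugeField (Psch (K + 1)) (lvlB K s + 1) G → ℝ}
  {εA εB : ℕ → ℝ} {ηA ηB : ℕ → ℝ} {DA ρA DB ρB : ℕ → ℝ} {DslotA MA : ℕ → ℝ → σ → ℝ}
  {DslotB MB : ℕ → ℝ → σ' → ℝ} {N₁ : ℕ} {νbar Dbar c₁ ϑ : ℝ}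

/-- **END-I ALONG THE CUTOFF SCHEME, FED IN THE FINE CURRENCY (γ8 junction, END-I side).**  S27's
`shellWeightBound_of_schemeData_age` for the RAW fine tested variables `uAf`, `uBf`: run A's slot `s` of comparison `K`
sits at level `lvlA K s` of the `K`-step run with fine scale `ηA (lvlA K s) > 0`, run B's at level `lvlB K s + 1` of the
`(K+1)`-step run with fine scale `ηB (lvlB K s + 1) > 0`; the per-slot (M1) binders `hacA`∕`hacB` are LITERALLY the
live-level END-II's conclusions at the thresholds `εA (K − lvlA K s) * ηA (lvlA K s) ^ 2`, resp.
`εB (K − lvlB K s) * ηB (lvlB K s + 1) ^ 2`, and `piece_le` reads the FINE shell events; inside, the variables are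
normalised by the run's own `η²` (`ShellMeasureThresholdUnits.slotAntiConcentration_thresholdUnits`, `shell_fine_eq`) and
S27's END is fired at the age thresholds.  CONCLUSION LITERALLY END-I's `ShellWeightBound …`.  CONDITIONAL on every
displayed binder; nothing printed asserted; (M1) realized ≠ NE7c. [folklore] -/
theorem shellWeightBound_of_schemeData_age_fine (hηA : ∀ j, 0 < ηA j) (hηB : ∀ j, 0 < ηB j)
    (hFfinA : ∀ K t s, ∫⁻ U, FA K t s U ∂(fieldMeasure (Psch K) (lvlA K s) G) ≠ ∞)
    (sh_nonnegA : ∀ K t, |t| ≤ l₀ → ∀ τ ∈ T K, 0 ≤ shA K t τ)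
    (sh_leA : ∀ K t, |t| ≤ l₀ → ∀ τ ∈ T K, shA K t τ ≤ A K t τ)
    (coverA : ∀ K t, |t| ≤ l₀ → ∀ τ ∈ T K, shA K t τ ≤ ∑ s ∈ SA K, pieceA K t s τ)
    (hMA : ∀ K t, |t| ≤ l₀ → ∀ s ∈ SA K, 0 ≤ MA K t s)
    (piece_leA : ∀ K t, |t| ≤ l₀ → ∀ s ∈ SA K, ∑ τ ∈ T K, pieceA K t s τ ≤ MA K t s *
      (((fieldMeasure (Psch K) (lvlA K s) G).withDensity (FA K t s))
        {x | εA (K - lvlA K s) * ηA (lvlA K s) ^ 2 * (1 - ρA (lvlA K s)) ≤ uAf K t s x ∧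
          uAf K t s x < εA (K - lvlA K s) * ηA (lvlA K s) ^ 2}).toReal)
    (total_geA : ∀ K t, |t| ≤ l₀ → ∀ s ∈ SA K,
      MA K t s * (((fieldMeasure (Psch K) (lvlA K s) G).withDensity (FA K t s)) Set.univ).toReal ≤ ∑ τ ∈ T K, A K t τ)
    (hDA0 : ∀ j, 0 ≤ DA j) (hρA0 : ∀ j, 0 ≤ ρA j)
    (hDslotA : ∀ K t, |t| ≤ l₀ → ∀ s ∈ SA K, DslotA K t s ≤ DA (lvlA K s))
    (hacA : ∀ K t, |t| ≤ l₀ → ∀ s ∈ SA K,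
      SlotAntiConcentration ((fieldMeasure (Psch K) (lvlA K s) G).withDensity (FA K t s)) (uAf K t s)
        (εA (K - lvlA K s) * ηA (lvlA K s) ^ 2) (ρA (lvlA K s)) (DslotA K t s))
    (hFfinB : ∀ K t s, ∫⁻ U, FB K t s U ∂(fieldMeasure (Psch (K + 1)) (lvlB K s + 1) G) ≠ ∞)
    (sh_nonnegB : ∀ K t, |t| ≤ l₀ → ∀ τ ∈ T K, 0 ≤ shB K t τ)
    (sh_leB : ∀ K t, |t| ≤ l₀ → ∀ τ ∈ T K, shB K t τ ≤ B K t τ)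
    (coverB : ∀ K t, |t| ≤ l₀ → ∀ τ ∈ T K, shB K t τ ≤ ∑ s ∈ SB K, pieceB K t s τ)
    (hMB : ∀ K t, |t| ≤ l₀ → ∀ s ∈ SB K, 0 ≤ MB K t s)
    (piece_leB : ∀ K t, |t| ≤ l₀ → ∀ s ∈ SB K, ∑ τ ∈ T K, pieceB K t s τ ≤ MB K t s *
      (((fieldMeasure (Psch (K + 1)) (lvlB K s + 1) G).withDensity (FB K t s))
        {x | εB (K - lvlB K s) * ηB (lvlB K s + 1) ^ 2 * (1 - ρB (lvlB K s)) ≤ uBf K t s x ∧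
          uBf K t s x < εB (K - lvlB K s) * ηB (lvlB K s + 1) ^ 2}).toReal)
    (total_geB : ∀ K t, |t| ≤ l₀ → ∀ s ∈ SB K,
      MB K t s * (((fieldMeasure (Psch (K + 1)) (lvlB K s + 1) G).withDensity (FB K t s)) Set.univ).toReal ≤
        ∑ τ ∈ T K, B K t τ)
    (hDB0 : ∀ j, 0 ≤ DB j) (hρB0 : ∀ j, 0 ≤ ρB j)
    (hDslotB : ∀ K t, |t| ≤ l₀ → ∀ s ∈ SB K, DslotB K t s ≤ DB (lvlB K s))
    (hacB : ∀ K t, |t| ≤ l₀ → ∀ s ∈ SB K,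
      SlotAntiConcentration ((fieldMeasure (Psch (K + 1)) (lvlB K s + 1) G).withDensity (FB K t s)) (uBf K t s)
        (εB (K - lvlB K s) * ηB (lvlB K s + 1) ^ 2) (ρB (lvlB K s)) (DslotB K t s))
    (hwA : LiveWindow SA lvlA N₁ νbar) (hwB : LiveWindow SB lvlB N₁ νbar) (hϑ0 : 0 < ϑ) (hϑ1 : ϑ < 1)
    (hDA : ∀ j, DA j ≤ Dbar) (hDB : ∀ j, DB j ≤ Dbar)
    (hrateA : ∀ j, ρA j ≤ c₁ * ϑ ^ j) (hrateB : ∀ j, ρB j ≤ c₁ * ϑ ^ j) :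
    ShellWeightBound l₀ T A B shA shB
      (fun K => ∑ s ∈ SA K, DA (lvlA K s) * ρA (lvlA K s) + ∑ s ∈ SB K, DB (lvlB K s) * ρB (lvlB K s)) := by
  -- the (R)+[dict] shell events in threshold units (same events)
  have pA : ∀ K t, |t| ≤ l₀ → ∀ s ∈ SA K, ∑ τ ∈ T K, pieceA K t s τ ≤ MA K t s *
      (((fieldMeasure (Psch K) (lvlA K s) G).withDensity (FA K t s))
        {x | εA (K - lvlA K s) * (1 - ρA (lvlA K s)) ≤ uAf K t s x / ηA (lvlA K s) ^ 2 ∧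
          uAf K t s x / ηA (lvlA K s) ^ 2 < εA (K - lvlA K s)}).toReal := by
    intro K t ht s hs
    rw [← shell_fine_eq (uAf K t s) _ _ (hηA _)]
    exact piece_leA K t ht s hs
  have pB : ∀ K t, |t| ≤ l₀ → ∀ s ∈ SB K, ∑ τ ∈ T K, pieceB K t s τ ≤ MB K t s *
      (((fieldMeasure (Psch (K + 1)) (lvlB K s + 1) G).withDensity (FB K t s))
        {x | εB (K - lvlB K s) * (1 - ρB (lvlB K s)) ≤ uBf K t s x / ηB (lvlB K s + 1) ^ 2 ∧
          uBf K t s x / ηB (lvlB K s + 1) ^ 2 < εB (K - lvlB K s)}).toReal := by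
    intro K t ht s hs
    rw [← shell_fine_eq (uBf K t s) _ _ (hηB _)]
    exact piece_leB K t ht s hs
  -- S27's END at the NORMALISED variables, the (M1)s transported by the unit change
  exact shellWeightBound_of_schemeData_age
    (uA := fun K t s x => uAf K t s x / ηA (lvlA K s) ^ 2)
    (uB := fun K t s x => uBf K t s x / ηB (lvlB K s + 1) ^ 2)
    hFfinA sh_nonnegA sh_leA coverA hMA pA total_geA hDA0 hρA0 hDslotA
    (fun K t ht s hs => slotAntiConcentration_thresholdUnits (hηA (lvlA K s)) (hacA K t ht s hs))
    hFfinB sh_nonnegB sh_leB coverB hMB pB total_geB hDB0 hρB0 hDslotB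
    (fun K t ht s hs => slotAntiConcentration_thresholdUnits (hηB (lvlB K s + 1)) (hacB K t ht s hs))
    hwA hwB hϑ0 hϑ1 hDA hDB hrateA hrateB

end Age

/-! ## Non-vacuity of the fine shell identity (trigger c3) -/

/-- On `ℝ`, `u = id`, `ε = 1`, `η = 1∕2`, `ρ = 0`: the fine shell `[1∕4, 1∕4)` and the normalised shell `[1, 1)` for
`u∕(1∕4)` are the same (empty) set. [folklore] -/
example : {x : ℝ | (1 : ℝ) * (1 / 2 : ℝ) ^ 2 * (1 - 0) ≤ id x ∧ id x < 1 * (1 / 2 : ℝ) ^ 2} =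
    {x : ℝ | (1 : ℝ) * (1 - 0) ≤ id x / (1 / 2 : ℝ) ^ 2 ∧ id x / (1 / 2 : ℝ) ^ 2 < 1} :=
  shell_fine_eq id 1 0 (by norm_num)

end Summit.QuantumFields.BalabanUV.T4Continuum.ShellMeasureThresholdUnitsEnd

end
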